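import Literature.Topology.ProperLocalHomeomorph
import Literature.Topology.FourManifolds.InverseFunctionTheorem
import Mathlib.Geometry.Manifold.Instances.Real
import HarnessLib

/-!
# Final assembly of the sweep: bijectivity by sheet counting, and the diffeomorphism

Topic `Literature/Topology/FourManifolds`; the last step of the smoothing of PD homeomorphisms
(Munkres, Ann. of Math. 72 (1960), §5; Campbell–D'Onofrio–Vítek (2026), Lemma 2.4 and §3.1, end
of the proof of Theorem 1).  After the sweep the modified identity `F : M → M` is a local
diffeomorphism from `(M, c₁)` to `(M, c₂)` at every point, and it agrees with the identity off a
locally finite union of compact tubes `K i` whose images `F '' K i` again form a locally finite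
family; deep interior points of top simplices lie off all of these.  Then:

* `IsLocalHomeomorph.bijective_of_eq_self_off_locallyFinite` — such an `F` is a bijection: it is
  proper (the preimage of a compact set is a closed subset of the set plus finitely many tubes),
  so the sheet count of `Literature/Topology/ProperLocalHomeomorph.lean` applies, and a point off
  `⋃ K i ∪ ⋃ F '' K i` has exactly one preimage (itself);
* `isLocalDiffeomorphAt_of_chart_formula` — the chart-level criterion used by the sweep at every
  point: if near `p` the map is `e'.symm ∘ g ∘ e` for charts `e`, `e'` of the maximal atlases and
  a map `g` of `ℝⁿ` which is `C^∞` near `e p` with invertible derivative there, then it is a local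
  diffeomorphism at `p` (charts are local diffeomorphisms; inverse function theorem on `ℝⁿ`;
  `IsLocalDiffeomorphAt.comp`; invariance under germs, `IsLocalDiffeomorphAt.congr_of_eventuallyEq`);
* `nonempty_diffeomorph_of_isLocalDiffeomorph_of_bijective` — a bijective map which is a local
  diffeomorphism everywhere is a diffeomorphism (Mathlib's
  `IsLocalDiffeomorph.diffeomorphOfBijective`).

Everything is proved; no definitions; no named facts.

## References

* J. R. Munkres, *Obstructions to the smoothing of piecewise-differentiable homeomorphisms*, Ann.
  of Math. (2) 72 (1960), 521–554, §5. [Munkres1960]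
* D. Campbell, L. D'Onofrio, T. Vítek, *Diffeomorphic approximation of piecewise affine
  homeomorphisms*, J. Geom. Anal. 36 (2026), Lemma 2.4, §3.1. [CampbellDonofrioVitek2026]
-/

noncomputable section

open Set Function Filter
open scoped Topology Manifold ContDiff

/-! ### Bijectivity by sheet counting -/

namespace Literature.Topology

variable {X : Type*} [TopologicalSpace X]

/-- **A local homeomorphism which is the identity off a locally finite union of compact sets is a
bijection.** Let `X` be Hausdorff and weakly locally compact, `f : X → X` a local homeomorphism,
`K i` compact sets with `f x = x` whenever `x` lies in no `K i`, such that the images `f '' K i`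
form a locally finite family, and suppose every point has in its connected component a point
lying in no `K i` and in no `f '' K i`.  Then `f` is a bijection.  (Proper by local finiteness;
one clean fibre per component; `IsLocalHomeomorph.bijective_of_forall_existsUnique`.)
[cite: CampbellDonofrioVitek2026, Lemma 2.4] -/
theorem IsLocalHomeomorph.bijective_of_eq_self_off_locallyFinite [T2Space X]
    [WeaklyLocallyCompactSpace X] {f : X → X} (hf : IsLocalHomeomorph f) {ι : Type*}
    {K : ι → Set X} (hK : ∀ i, IsCompact (K i)) (hlf : LocallyFinite fun i => f '' K i)
    (heq : ∀ x, (∀ i, x ∉ K i) → f x = x)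
    (hclean : ∀ y, ∃ y' ∈ connectedComponent y, (∀ i, y' ∉ K i) ∧ ∀ i, y' ∉ f '' K i) :
    Bijective f := by
  classical
  -- properness
  have hprop : IsProperMap f := by
    rw [isProperMap_iff_isCompact_preimage]
    refine ⟨hf.continuous, fun L hL => ?_⟩
    obtain ⟨t, ht⟩ : {i | (f '' K i ∩ L).Nonempty}.Finite := hlf.finite_nonempty_inter_compact hL
    have hsub : f ⁻¹' L ⊆ L ∪ ⋃ i ∈ ({i | (f '' K i ∩ L).Nonempty} : Set ι), K i := by
      intro x hx
      by_cases h : ∀ i, x ∉ K i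
      · left
        have : f x ∈ L := hx
        rwa [heq x h] at this
      · simp only [not_forall, not_not] at h
        obtain ⟨i, hi⟩ := h
        right
        exact mem_iUnion₂.2 ⟨i, ⟨f x, ⟨x, hi, rfl⟩, hx⟩, hi⟩
    refine (hL.union ?_).of_isClosed_subset (hL.isClosed.preimage hf.continuous) hsub
    exact (hlf.finite_nonempty_inter_compact hL).isCompact_biUnion fun i _ => hK i
  -- one clean fibre in each component
  refine IsLocalHomeomorph.bijective_of_forall_existsUnique hf hprop fun y => ?_
  obtain ⟨y', hy', hK', hfK'⟩ := hclean y
  refine ⟨y', hy', y', heq y' hK', fun x hx => ?_⟩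
  by_cases h : ∀ i, x ∉ K i
  · exact (heq x h).symm.trans hx
  · simp only [not_forall, not_not] at h
    obtain ⟨i, hi⟩ := h
    exact absurd ⟨x, hi, hx⟩ (hfK' i)

end Literature.Topology

/-! ### The local-diffeomorphism criterion in charts, and the diffeomorphism -/

namespace Literature.Topology.FourManifolds

variable {n : ℕ}
variable {M : Type*} [TopologicalSpace M] [ChartedSpace (EuclideanSpace ℝ (Fin n)) M]
variable {N : Type*} [TopologicalSpace N] [ChartedSpace (EuclideanSpace ℝ (Fin n)) N]

/-- A chart of the maximal `C^∞` atlas is a local diffeomorphism onto the model space at every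
point of its source. [folklore] -/
theorem isLocalDiffeomorphAt_of_mem_maximalAtlas [IsManifold (𝓡 n) ∞ M]
    {e : OpenPartialHomeomorph M (EuclideanSpace ℝ (Fin n))}
    (he : e ∈ IsManifold.maximalAtlas (𝓡 n) ∞ M) {p : M} (hp : p ∈ e.source) :
    IsLocalDiffeomorphAt (𝓡 n) (𝓡 n) ∞ e p := by
  let Φ : PartialDiffeomorph (𝓡 n) (𝓡 n) M (EuclideanSpace ℝ (Fin n)) ∞ :=
    { toPartialEquiv := e.toPartialEquiv
      open_source := e.open_source
      open_target := e.open_target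
      contMDiffOn_toFun := contMDiffOn_of_mem_maximalAtlas he
      contMDiffOn_invFun := contMDiffOn_symm_of_mem_maximalAtlas he }
  exact ⟨Φ, hp, fun _ _ => rfl⟩

/-- The inverse of a chart of the maximal `C^∞` atlas is a local diffeomorphism at every point
of its target. [folklore] -/
theorem isLocalDiffeomorphAt_symm_of_mem_maximalAtlas [IsManifold (𝓡 n) ∞ M]
    {e : OpenPartialHomeomorph M (EuclideanSpace ℝ (Fin n))}
    (he : e ∈ IsManifold.maximalAtlas (𝓡 n) ∞ M) {z : EuclideanSpace ℝ (Fin n)}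
    (hz : z ∈ e.target) : IsLocalDiffeomorphAt (𝓡 n) (𝓡 n) ∞ e.symm z := by
  let Φ : PartialDiffeomorph (𝓡 n) (𝓡 n) (EuclideanSpace ℝ (Fin n)) M ∞ :=
    { toPartialEquiv := e.symm.toPartialEquiv
      open_source := e.open_target
      open_target := e.open_source
      contMDiffOn_toFun := contMDiffOn_symm_of_mem_maximalAtlas he
      contMDiffOn_invFun := by
        have : (e.symm.toPartialEquiv).target = e.source := rfl
        simpa using contMDiffOn_of_mem_maximalAtlas he }
  exact ⟨Φ, hz, fun _ _ => rfl⟩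

/-- **Inverse function theorem on `ℝⁿ` in manifold language**: a map of `ℝⁿ` which is `C^∞` on
an open set `U ∋ z` with invertible derivative at `z` is a local diffeomorphism at `z`.
[folklore] -/
theorem isLocalDiffeomorphAt_euclidean {g : EuclideanSpace ℝ (Fin n) → EuclideanSpace ℝ (Fin n)}
    {U : Set (EuclideanSpace ℝ (Fin n))} (hU : IsOpen U) {z : EuclideanSpace ℝ (Fin n)}
    (hz : z ∈ U) (hg : ContDiffOn ℝ ∞ g U)
    (L : EuclideanSpace ℝ (Fin n) ≃L[ℝ] EuclideanSpace ℝ (Fin n))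
    (hL : HasFDerivAt g (L : EuclideanSpace ℝ (Fin n) →L[ℝ] EuclideanSpace ℝ (Fin n)) z) :
    IsLocalDiffeomorphAt (𝓡 n) (𝓡 n) ∞ g z := by
  refine isLocalDiffeomorphAt_of_hasFDerivAt_writtenInExtChartAt hU hz
    (contMDiffOn_iff_contDiffOn.2 hg) (by simp) L ?_
  have hw : writtenInExtChartAt (𝓡 n) (𝓡 n) z g = g := by
    ext w
    simp [writtenInExtChartAt]
  rw [hw]
  simpa using hL

omit [ChartedSpace (EuclideanSpace ℝ (Fin n)) M] in
/-- Local diffeomorphisms are a germ notion: a map which agrees near `x` with a local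
diffeomorphism at `x` is one. [folklore] -/
theorem IsLocalDiffeomorphAt.congr_of_eventuallyEq {H : Type*} [TopologicalSpace H]
    {E' : Type*} [NormedAddCommGroup E'] [NormedSpace ℝ E'] {I : ModelWithCorners ℝ E' H}
    [ChartedSpace H M] {N' : Type*} [TopologicalSpace N'] {H' : Type*} [TopologicalSpace H']
    {E'' : Type*} [NormedAddCommGroup E''] [NormedSpace ℝ E''] {J : ModelWithCorners ℝ E'' H'}
    [ChartedSpace H' N'] {m : WithTop ℕ∞} {ψ F : M → N'} {x : M}
    (h : IsLocalDiffeomorphAt I J m ψ x) (hF : F =ᶠ[𝓝 x] ψ) : IsLocalDiffeomorphAt I J m F x := by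
  obtain ⟨Φ, hx, heq⟩ := h
  obtain ⟨O, hOsub, hOo, hxO⟩ := mem_nhds_iff.1 hF
  -- restrict `Φ` to `Φ.source ∩ O`
  let pe : PartialEquiv M N' := Φ.toPartialEquiv.restr O
  have hsrc : pe.source = Φ.source ∩ O := by simp [pe, PartialEquiv.restr_source]
  have htgt : pe.target = Φ.target ∩ Φ.toPartialEquiv.symm ⁻¹' O := rfl
  have hopen_t : IsOpen pe.target := by
    rw [htgt]
    exact Φ.toOpenPartialHomeomorph.isOpen_inter_preimage_symm hOo
  let Ψ : PartialDiffeomorph I J M N' m :=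
    { toPartialEquiv := pe
      open_source := by rw [hsrc]; exact Φ.open_source.inter hOo
      open_target := hopen_t
      contMDiffOn_toFun := Φ.contMDiffOn_toFun.mono (by rw [hsrc]; exact inter_subset_left)
      contMDiffOn_invFun := Φ.contMDiffOn_invFun.mono (by rw [htgt]; exact inter_subset_left) }
  refine ⟨Ψ, ?_, ?_⟩
  · show x ∈ pe.source
    rw [hsrc]; exact ⟨hx, hxO⟩
  · intro y hy
    have hy' : y ∈ Φ.source ∩ O := by rwa [← hsrc]
    rw [hOsub hy'.2, heq hy'.1]
    rfl

/-- **The chart-level criterion.** Let `F : M → N`, `e` a chart of the maximal atlas of `M` with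
`p ∈ e.source`, `e'` a chart of the maximal atlas of `N`, and suppose that near `p` the map `F`
is `e'.symm ∘ g ∘ e` for a map `g` of `ℝⁿ` which is `C^∞` on an open `U ∋ e p`, has invertible
derivative at `e p`, and sends `e p` into `e'.target`.  Then `F` is a local diffeomorphism at
`p`. [folklore] -/
theorem isLocalDiffeomorphAt_of_chart_formula [IsManifold (𝓡 n) ∞ M] [IsManifold (𝓡 n) ∞ N]
    {F : M → N} {p : M} {e : OpenPartialHomeomorph M (EuclideanSpace ℝ (Fin n))}
    (he : e ∈ IsManifold.maximalAtlas (𝓡 n) ∞ M) (hp : p ∈ e.source)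
    {e' : OpenPartialHomeomorph N (EuclideanSpace ℝ (Fin n))}
    (he' : e' ∈ IsManifold.maximalAtlas (𝓡 n) ∞ N)
    {g : EuclideanSpace ℝ (Fin n) → EuclideanSpace ℝ (Fin n)}
    (hF : F =ᶠ[𝓝 p] fun q => e'.symm (g (e q))) {U : Set (EuclideanSpace ℝ (Fin n))}
    (hU : IsOpen U) (hpU : e p ∈ U) (hg : ContDiffOn ℝ ∞ g U)
    (L : EuclideanSpace ℝ (Fin n) ≃L[ℝ] EuclideanSpace ℝ (Fin n))
    (hL : HasFDerivAt g (L : EuclideanSpace ℝ (Fin n) →L[ℝ] EuclideanSpace ℝ (Fin n)) (e p))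
    (hgt : g (e p) ∈ e'.target) : IsLocalDiffeomorphAt (𝓡 n) (𝓡 n) ∞ F p := by
  have h1 : IsLocalDiffeomorphAt (𝓡 n) (𝓡 n) ∞ e p := isLocalDiffeomorphAt_of_mem_maximalAtlas he hp
  have h2 : IsLocalDiffeomorphAt (𝓡 n) (𝓡 n) ∞ g (e p) := isLocalDiffeomorphAt_euclidean hU hpU hg L hL
  have h3 : IsLocalDiffeomorphAt (𝓡 n) (𝓡 n) ∞ e'.symm (g (e p)) :=
    isLocalDiffeomorphAt_symm_of_mem_maximalAtlas he' hgt
  have h12 : IsLocalDiffeomorphAt (𝓡 n) (𝓡 n) ∞ (g ∘ e) p := h1.comp (hg := h2)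
  have hcomp : IsLocalDiffeomorphAt (𝓡 n) (𝓡 n) ∞ (e'.symm ∘ (g ∘ e)) p := h12.comp (hg := h3)
  exact IsLocalDiffeomorphAt.congr_of_eventuallyEq hcomp hF

/-- **A bijection which is a local diffeomorphism at every point is a diffeomorphism** (Mathlib's
`IsLocalDiffeomorph.diffeomorphOfBijective`, packaged as `Nonempty`). [folklore] -/
theorem nonempty_diffeomorph_of_isLocalDiffeomorph_of_bijective {F : M → N}
    (hF : ∀ p, IsLocalDiffeomorphAt (𝓡 n) (𝓡 n) ∞ F p) (hb : Bijective F) :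
    Nonempty (M ≃ₘ⟮𝓡 n, 𝓡 n⟯ N) :=
  ⟨IsLocalDiffeomorph.diffeomorphOfBijective hF hb⟩

end Literature.Topology.FourManifolds
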